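import Summits.ResolutionOfSingularities.ResolutionOfSingularities.Theorems.PurelyInseparableDim4OneStepReduction
import Literature.AlgebraicGeometry.Resolution.AffinePointBlowupLocal
import HarnessLib

/-!
# Purely inseparable four-folds: the POINT blow-up of ANY ambient met along the walk reads, on an affine chart, as the
# model step (brick TY-3j part 1 «LOCAL MODEL, POINT CENTRE», cell `res-dim4-pi`)

[OURS · counted 0] (D-0157 DOOR 2; first piece of the depth-`n` assembly of `PIDim4.TerminationImpliesOrderReduction` for
POINT centres (MODE 0 / the ISOLATED regime of the desk's frame v4); host item stmt-ResolutionOfSingularities-16155,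
helper). Nothing here proves resolution of singularities in dimension ≥ 4 / characteristic `p`.

After the first blow-up the ambient is no longer `𝔸⁵_K`; what survives is an AFFINE CHART at the point: an open `V ∋ x₀`
of the ambient `Z` with an isomorphism `e : V ≅ 𝔸⁵_K` sending `x₀` to the origin (the tree's
`AffinePointBlowup.HasAffineChart` pattern) under which the marked ideal reads `(z^p + F)·𝒪`:
`(M.ideal.comap V.ι).comap e.inv = hypSheaf p s.F`. For ANY blowing up `π : W → Z` of the closed point `x₀`:

* `centreVars_univ`, `isBlowup_chart` — over the chart, `(π ∣_ V) ≫ e.hom : π⁻¹V → 𝔸⁵_K` is a blowing up along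
  `V(z, x₁, …, x₄)` = `AffineCoordBlowup.𝓘Λ 4 K Λ_univ` (tree `isBlowup_restrict_comp_affineChart`, `𝓘Λ_univ`);
* `comap_eq_of_comap_comap_inv` — bookkeeping `(I.comap V.ι).comap e.inv = J ↔ I.comap V.ι = J.comap e.hom`;
* **`comap_transform_ideal_restrict`** — `(M.transform π 𝓘_{x₀}).ideal|_{π⁻¹V} = σᶜ_{(π∣V) ≫ e}((z^p + F)·𝒪, p)` (flat base
  change of the controlled transform along the open immersion `(π⁻¹V).ι`, tree `comap_controlledTransform_of_flat`);
* **`comap_transform_ideal_chart`** — along the composite OPEN IMMERSION `chartImm_j ≫ (π⁻¹V).ι : 𝔸⁵_K ⟶ W` (`j : Fin 4`)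
  the transformed ideal is `hypSheaf p (CentreBlowup.chartTransform p univ j s.F)` (typ-2's
  `controlledTransform_comap_chartImm`): EVERY socket lemma of TY-3c/3e/3f (`…_of_comap_eq`) applies to `W`;
* `isEquimultiplePoint_iff_idealOrder_transform_ge` — the instance: for the rational point `x = (a, b)` of the
  `x_j`-chart with `a^p + F′_j(b) = 0`, `IsEquimultiplePoint p univ j b s ↔ p ≤ ord (M.transform π 𝓘_{x₀}).ideal` at the
  image of `x` in `W`.

Part 2 (the NEW affine chart at such a point, with equation `hypSheaf p (step p univ j b s).F` — (c5) of the typ-3 memo)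
follows. AI-produced formalisation, weaker than expert review. bears_on: LADDER-RESOLUTION:D157-DOOR2 (res-dim4-pi · TY-3j).
-/

set_option linter.dupNamespace false -- D-0017: single-problem summit path `Summit.<S>.<S>.…` by design

noncomputable section

open MvPolynomial Finset CategoryTheory AlgebraicGeometry Opposite TopologicalSpace

namespace Summit.ResolutionOfSingularities.ResolutionOfSingularities.Theorems.PIDim4

open Literature.AlgebraicGeometry.Resolution
open Literature.AlgebraicGeometry.Resolution.Hauser2010
open Literature.AlgebraicGeometry.Resolution.AffinePointBlowup (P A γ coord Wtop ξ)

namespace Equimultiple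

section PointChart

variable {K : Type} [Field K] {p : ℕ} [hp : Fact p.Prime] [CharP K p]
variable {Z W : Scheme.{0}} {π : W ⟶ Z} {x₀ : Z} {V : Z.Opens}

omit hp [CharP K p] in
/-- The centre variables of the POINT centre are all of `z, x₁, …, x₄`. [folklore] -/
theorem centreVars_univ :
    (insert 0 (Fin.succ '' ((Finset.univ : Finset (Fin 4)) : Set (Fin 4))) : Set (Fin (4 + 1))) = Set.univ := by
  ext i
  simp only [Finset.coe_univ, Set.image_univ, Set.mem_insert_iff, Set.mem_range, Set.mem_univ, iff_true]
  exact Fin.cases (Or.inl rfl) (fun j => Or.inr ⟨j, rfl⟩) i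

omit hp [CharP K p] in
/-- **Over an affine chart at `x₀`, a blowing up of the point `x₀` is a blowing up of `𝔸⁵_K` along the point centre
`V(z, x₁, …, x₄)`** (in the coordinate-centre vocabulary of the cell, `Λ = Λ_univ`).
[cite: GortzWedhorn2020, Prop. 13.91 (blow-ups and flat base change)] -/
theorem isBlowup_chart (hx₀ : IsClosed ({x₀} : Set Z)) (hx₀V : x₀ ∈ V) (e : (V : Scheme.{0}) ≅ P 4 K)
    (hex₀ : e.hom.base ⟨x₀, hx₀V⟩ = ξ 4 K)
    (hπ : IsBlowup π (Scheme.IdealSheafData.vanishingIdeal (⟨{x₀}, hx₀⟩ : Closeds Z))) :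
    IsBlowup ((π ∣_ V) ≫ e.hom)
      (AffineCoordBlowup.𝓘Λ 4 K (insert 0 (Fin.succ '' ((Finset.univ : Finset (Fin 4)) : Set (Fin 4))))) := by
  rw [centreVars_univ, AffineCoordBlowup.𝓘Λ_univ]
  exact AffinePointBlowup.isBlowup_restrict_comp_affineChart hx₀ hx₀V e hex₀ hπ

omit hp [CharP K p] in
/-- Bookkeeping along the chart isomorphism: `(I|_V).comap e⁻¹ = J ↔ I|_V = J.comap e`. [folklore] -/
theorem comap_eq_of_comap_comap_inv (e : (V : Scheme.{0}) ≅ P 4 K) {I : (V : Scheme.{0}).IdealSheafData}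
    {J : (P 4 K).IdealSheafData} (h : I.comap e.inv = J) : I = J.comap e.hom := by
  rw [← h, ← Scheme.IdealSheafData.comap_comp, e.hom_inv_id, Scheme.IdealSheafData.comap_id]

omit hp [CharP K p] in
/-- **The transformed marked ideal restricted over the chart** is the controlled transform, with respect to the
blowing up `(π ∣_ V) ≫ e` of `𝔸⁵_K` along the point centre, of the model ideal `(z^p + F)·𝒪`.
[cite: BierstoneGrigorievMilmanWlodarczyk2011, §3.2 with Thm. 8.0.5 (controlled transforms and flat base change)] -/
theorem comap_transform_ideal_restrict [IsLocallyNoetherian Z] (hx₀ : IsClosed ({x₀} : Set Z)) (hx₀V : x₀ ∈ V)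
    (e : (V : Scheme.{0}) ≅ P 4 K) (hex₀ : e.hom.base ⟨x₀, hx₀V⟩ = ξ 4 K) (M : MarkedIdeal Z) (s : State K)
    (hM : (M.ideal.comap V.ι).comap e.inv = hypSheaf p s.F)
    (hπ : IsBlowup π (Scheme.IdealSheafData.vanishingIdeal (⟨{x₀}, hx₀⟩ : Closeds Z))) :
    (M.transform π (Scheme.IdealSheafData.vanishingIdeal (⟨{x₀}, hx₀⟩ : Closeds Z))).ideal.comap (π ⁻¹ᵁ V).ι =
      controlledTransform ((π ∣_ V) ≫ e.hom)
        (AffineCoordBlowup.𝓘Λ 4 K (insert 0 (Fin.succ '' ((Finset.univ : Finset (Fin 4)) : Set (Fin 4)))))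
        (hypSheaf p s.F) M.mult := by
  haveI : IsProper π := hπ.isProper
  haveI : IsLocallyNoetherian W := LocallyOfFiniteType.isLocallyNoetherian π
  have hsq : (π ⁻¹ᵁ V).ι ≫ π = (π ∣_ V) ≫ V.ι := (morphismRestrict_ι π V).symm
  rw [MarkedIdeal.transform_ideal, comap_controlledTransform_of_flat (t := V.ι) hsq]
  -- move the centre and the ideal across the chart isomorphism `e`
  have hC : (Scheme.IdealSheafData.vanishingIdeal (⟨{x₀}, hx₀⟩ : Closeds Z)).comap V.ι =
      (AffineCoordBlowup.𝓘Λ 4 K (insert 0 (Fin.succ '' ((Finset.univ : Finset (Fin 4)) : Set (Fin 4))))).comap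
        e.hom := by
    rw [centreVars_univ, AffineCoordBlowup.𝓘Λ_univ]
    exact comap_eq_of_comap_comap_inv e
      (AffinePointBlowup.comap_comap_vanishingIdeal_singleton_eq_𝓘 hx₀ hx₀V e hex₀)
  have hI : M.ideal.comap V.ι = (hypSheaf p s.F).comap e.hom := comap_eq_of_comap_comap_inv e hM
  rw [hC, hI, controlledTransform, controlledTransform, Scheme.IdealSheafData.comap_comp,
    Scheme.IdealSheafData.comap_comp]

omit hp [CharP K p] in
/-- **Along the composite open immersion `chartImm_j ≫ (π⁻¹V).ι : 𝔸⁵_K ⟶ W` the transformed ideal is the model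
`(z^p + F′_j)·𝒪`**, `F′_j = CentreBlowup.chartTransform p univ j F` (`p ≤ ord₀ F`, i.e. the point is `p`-fold).
Consequently every «socket» lemma of TY-3c/3e/3f applies to point blow-ups of an arbitrary ambient with an affine chart.
[cite: BierstoneGrigorievMilmanWlodarczyk2011, §3.2 and Lemma 8.0.3 (2)] -/
theorem comap_transform_ideal_chart [IsLocallyNoetherian Z] (hx₀ : IsClosed ({x₀} : Set Z)) (hx₀V : x₀ ∈ V)
    (e : (V : Scheme.{0}) ≅ P 4 K) (hex₀ : e.hom.base ⟨x₀, hx₀V⟩ = ξ 4 K) (M : MarkedIdeal Z) (hmult : M.mult = p)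
    (s : State K) (hM : (M.ideal.comap V.ι).comap e.inv = hypSheaf p s.F)
    (hperm : (p : ℕ∞) ≤ CentreBlowup.ordAlong (Finset.univ : Finset (Fin 4)) s.F)
    (hπ : IsBlowup π (Scheme.IdealSheafData.vanishingIdeal (⟨{x₀}, hx₀⟩ : Closeds Z))) (j : Fin 4) :
    (M.transform π (Scheme.IdealSheafData.vanishingIdeal (⟨{x₀}, hx₀⟩ : Closeds Z))).ideal.comap
        (AffineCoordBlowup.chartImm (isBlowup_chart hx₀ hx₀V e hex₀ hπ)
            (ChartDictionary.succ_mem_centreVars (Finset.mem_univ j)) ≫ (π ⁻¹ᵁ V).ι) =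
      hypSheaf p (CentreBlowup.chartTransform p Finset.univ j s.F) := by
  rw [Scheme.IdealSheafData.comap_comp, comap_transform_ideal_restrict hx₀ hx₀V e hex₀ M s hM hπ, hmult]
  exact ChartDictionary.controlledTransform_comap_chartImm p (Finset.mem_univ j) s.F hperm
    (isBlowup_chart hx₀ hx₀V e hex₀ hπ)

/-- **Instance of the socket: equimultiple = order `p` on `W`.** For the rational point `x = (a, b)` of the `x_j`-chart
with `a^p + F′_j(b) = 0`: `IsEquimultiplePoint p univ j b s ↔ p ≤ ord (M.transform π 𝓘_{x₀}).ideal` at the image of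
`x` in `W`. [cite: Hauser2010, §F (equiconstant points)] -/
theorem isEquimultiplePoint_iff_idealOrder_transform_ge [IsLocallyNoetherian Z] (hx₀ : IsClosed ({x₀} : Set Z))
    (hx₀V : x₀ ∈ V) (e : (V : Scheme.{0}) ≅ P 4 K) (hex₀ : e.hom.base ⟨x₀, hx₀V⟩ = ξ 4 K) (M : MarkedIdeal Z)
    (hmult : M.mult = p) (s : State K) (hM : (M.ideal.comap V.ι).comap e.inv = hypSheaf p s.F)
    (hperm : (p : ℕ∞) ≤ CentreBlowup.ordAlong (Finset.univ : Finset (Fin 4)) s.F)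
    (hπ : IsBlowup π (Scheme.IdealSheafData.vanishingIdeal (⟨{x₀}, hx₀⟩ : Closeds Z))) (j : Fin 4)
    (b : Fin 4 → K) (a : K) (hab : a ^ p + MvPolynomial.eval b (CentreBlowup.chartTransform p Finset.univ j s.F) = 0)
    {x : P 4 K} (hx : x.asIdeal = MvPolynomial.vanishingIdeal K {(Fin.cons a b : Fin (4 + 1) → K)}) :
    CentreBlowup.IsEquimultiplePoint p Finset.univ j b s ↔
      (p : ℕ∞) ≤ idealOrder (M.transform π (Scheme.IdealSheafData.vanishingIdeal (⟨{x₀}, hx₀⟩ : Closeds Z))).ideal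
        ((AffineCoordBlowup.chartImm (isBlowup_chart hx₀ hx₀V e hex₀ hπ)
            (ChartDictionary.succ_mem_centreVars (Finset.mem_univ j)) ≫ (π ⁻¹ᵁ V).ι) x) :=
  isEquimultiplePoint_iff_idealOrder_ge_of_comap_eq _ _ Finset.univ j b s a hab
    (comap_transform_ideal_chart hx₀ hx₀V e hex₀ M hmult s hM hperm hπ j) hx

end PointChart

end Equimultiple

end Summit.ResolutionOfSingularities.ResolutionOfSingularities.Theorems.PIDim4

end
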